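import Summits.QuantumFields.YangMills.Theorems.BalabanUVNodesN07Letters10OfRealRows
import HarnessLib

/-!
# BalabanUVNodes ∕ N07 — S6, THE SECOND-ORDER LETTER OF THE (165)-TOKEN THROUGH HODGE: **`∂^{ξ*}∂^ξ = Δ^ξ − ∂^ξ∂^{ξ*}` at the flat background, read componentwise
# through the real functionals of `M_N(ℂ)`** — the `‖∂^{ξ*}∂^ξ𝔄‖` member of g0's `Letters10On Y ξ t 𝔄` from a LAPLACIAN row and a GRADIENT-OF-DIVERGENCE row of the real
# fields `φ ∘ 𝔄` (print's road (134)–(136) for the heart's `A₁` at `U₀ = 1`: «(Δ + DRD*)A₀ = (D*D + DD*)A₀ + (Δ′ − DPD*)A₀ … the bound for this operator follows from the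
# inequality (3.49) [5] for DPD*»; n07-e g18's ANSWER to this seat's LOCATED-2ND-ORDER, INBOX l.27998 (ii); dag-lead WIDTH-209 N07 piece 4)

Cell `pub-ymgap`, width seat `pub-ymgap-dag-n07-w4` gen 2 (director-ym №197 ∕ HUMAN RULING D-0149), node N07 = [15] = [Balaban1985Variational] (CMP **102** (1985) 277–309);
[5] = [Balaban1985BackgroundPropagators] (CMP **99** 389–434); [B5] = [Balaban1984PropagatorsI].  `--kind proof --supports stmt-QuantumFields-20542 --as helper`; count-neutral;
def-free.  CONSUMED BY NAME, nothing restated: lit-balaban's `B8Eq12HodgeLaplacianV1.hodge_apply` ([B5] (1.69) «Δ = ∂*∂ + ∂∂*» on `ℓ²(bonds)`), `B6SectAOperatorsV1.dcE ∕ dcsE ∕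
dE ∕ dsE`, `LatticeFieldCalculus.laplace`, and this seat's FILE 1 (`letters10On_of_realRows`, `apply_codiffCurlA_eq_dcsE_dcE`).

WHY.  The S6 token's third letter is `‖(∂^{ξ*}∂^ξA)(b)‖` of the FULL potential `A = A₁ + HB − HD(A₁+HB)` ((159)).  For `HB` and `HD(·)` the `∂*∂` row IS a P2 letter
(`HDecayLetterD` row 3, print (139)); for the tangent part `A₁ = −G̃_V(…)` it is NOT (UST VET g2 V1: the `∂*∂G̃` row is false; print p. 296 L25–31 says so).  Print's road
(p. 298 (134)–(136), read at Sect. F's flat background, n07-e l.27998): `∂*∂A₁ = ΔA₁ − ∂∂*A₁`, where `ΔA₁` is controlled by the V-slot of (158) (`QA₁ = 0`, `R∂*A₁ = 0` ⇒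
`Δ_aA₁ = ΔA₁ = −(δV₁∕δA′)(A₁ + HB)`: k0-s1-w2's (98)-slot letters) and `∂∂*A₁ = ∂P∂*A₁` by ONE operator estimate, [5] Thm 3.2 (3.49) «`DPD*` bounded» (a port letter).
THIS FILE is the tower-agnostic plumbing between those two rows and the token: Hodge on `ℓ²(bonds)` componentwise (§1), the triangle inequality (§2), and FILE 1's duality
assembly with the third row REPLACED by a Laplacian row + a `∂∂*` row (§3).  It does NOT assume «`∂^{ξ*}A` locally constant» (n07-e: not available from (153)'s multiplier form).

CONTENTS (generic `P : Params`, `N`).  §1 `dcsE_dcE_apply_eq_laplace_sub` (`(∂*∂F)(b) = (ΔF_{b_dir})(b₋) − (∂∂*F)(b)` on `ℓ²(bonds)`), `laplace_apply_eq_sum_rows` (the Laplacian in the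
P2 row shape `c²·Σ_ν((F b − F(b₋+e_ν)) + (F b − F(b₋−e_ν)))`), ★ `apply_codiffCurlA_eq_laplace_sub` (33b's torus letter through `φ` = Laplacian − gradient-of-divergence of
`φ ∘ 𝔄`); §2 `abs_dcsE_dcE_le_add`; §3 ★★★ `letters10On_of_realRows_hodge` (sup + gradient rows at bound `q`, Laplacian row `q_Δ`, `∂∂*` row `q_P` with `q_Δ + q_P ≤ q < t`
⇒ `Letters10On Y ξ t 𝔄`).

HONEST FRAMING: count-neutral kernel bookkeeping; the two rows (the V-slot Laplacian bound and the (3.49) `DPD*` letter) are HYPOTHESES — their discharge is WIDTH-209 N07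
piece 4 (S4 ∕ port lanes); nothing of [15]∕[5]∕[B5] asserted; tokens NOT discharged; stub 1 ∕ K0⁷ ∕ K1⁷ NOT closed; N07 NOT discharged; counts unmoved (typed 28∕28 ·
discharged 5∕27); one finite 𝕋⁴ programme at fixed ε — R4 closes the conditional finite-𝕋⁴ rung `BalabanLadder.UV` ONLY; the YM mass gap (Clay) is NOT proved by any of this;
nothing continuum ∕ ℝ⁴ ∕ OS.  No `def`, no `instance`, no `notation`, no `sorry`.
-/

set_option autoImplicit false

noncomputable section

open scoped BigOperators Matrix.Norms.L2Operator

namespace Summit.QuantumFields.YangMills.BalabanUVNodes.N07SecondOrderLetterHodge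

open Literature.MathematicalPhysics.QuantumFieldTheory.Balaban1983to89
open Literature.MathematicalPhysics.QuantumFieldTheory.Balaban1983to89.Node00
open LatticeFieldCalculus (laplace)
open B6SectAOperatorsV1 (dcE dcsE dE dsE)
open B8Eq12HodgeLaplacianV1 (hodge_apply)
open Literature.MathematicalPhysics.QuantumFieldTheory.BalabanImbrieJaffe1984to88.BIJ85AxialPropagator411 (BondSpace)
open Summit.QuantumFields.YangMills.BalabanUVNodes.N07HalvingStepTopOfLocalLetters (Letters10On)
open Summit.QuantumFields.YangMills.BalabanUVNodes.N07Letters10OfRealRows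
  (letters10On_of_realRows apply_grad apply_codiffCurlA_eq_dcsE_dcE reFunctional_add reFunctional_smul)
open Summit.QuantumFields.YangMills.Theorems.HalvingQuarterMatrix (norm_le_of_forall_reFunctional)

variable {P : Params} {N : ℕ}

/-! ## §1  Hodge on `ℓ²(bonds)`, pointwise: `∂*∂ = Δ − ∂∂*` -/

/-- **[B5] (1.69) POINTWISE, SOLVED FOR `∂*∂`**: `(∂*∂F)(b) = (ΔF_{b_dir})(b₋) − (∂∂*F)(b)` for every real bond field `F` on the fine torus (`hodge_apply`).
[cite: Balaban1984PropagatorsI, (1.69) p.29, (1.21) p.21; Balaban1985Variational, (134) p.298] -/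
theorem dcsE_dcE_apply_eq_laplace_sub (c : ℝ) (F : BondSpace P) (b : PBond P 0) :
    dcsE c (dcE c F) b = laplace c (fun z => F ⟨z, b.dir⟩) b.src - dE c (dsE c F) b := by
  rw [← hodge_apply c F b, PiLp.add_apply]
  ring

/-- **THE LAPLACIAN IN THE P2 ROW SHAPE**: `(ΔF_{b_dir})(b₋) = c²·Σ_ν ((F b − F(b₋+e_ν, b_dir)) + (F b − F(b₋−e_ν, b_dir)))` — the fourth row of k0-s1-w3's `HDecayLetterD` ∕
`GtLaplaceLetterG` (`(Lᵏ)²·|Σ_ν …|`) IS `|laplace (Lᵏ) …|`. [cite: Balaban1984PropagatorsI, (1.21) p.21; Balaban1985Variational, (165) p.304] -/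
theorem laplace_apply_eq_sum_rows (c : ℝ) (F : PBond P 0 → ℝ) (b : PBond P 0) :
    laplace c (fun z => F ⟨z, b.dir⟩) b.src =
      c ^ 2 * ∑ ν : Fin P.d, ((F b - F ⟨b.src.shift ν, b.dir⟩) + (F b - F ⟨b.src.unshift ν, b.dir⟩)) := by
  unfold laplace
  rw [Finset.mul_sum]
  refine Finset.sum_congr rfl fun ν _ => ?_
  simp only [smul_eq_mul]
  ring

/-- ★ **33b's SECOND-ORDER TORUS LETTER THROUGH `φ` = LAPLACIAN − GRADIENT OF DIVERGENCE of `φ ∘ 𝔄`**: for every additive real-homogeneous `φ`,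
`φ((∂^{ξ*}∂^ξ𝔄)(x, x+e_μ)) = (Δ^{ξ⁻¹}(φ ∘ 𝔄)_μ)(x) − (∂∂*(φ ∘ 𝔄))(⟨x, μ⟩)` (FILE 1's dictionary ∘ Hodge).
[cite: Balaban1985Variational, (134)–(136) p.298, (165) p.304; Balaban1984PropagatorsI, (1.69) p.29] -/
theorem apply_codiffCurlA_eq_laplace_sub {φ : MatA N → ℝ} (hadd : ∀ M M' : MatA N, φ (M + M') = φ M + φ M')
    (hsmul : ∀ (a : ℝ) (M : MatA N), φ ((a : ℂ) • M) = a * φ M) (ξ : ℝ) (A : PBond P 0 → MatA N) (x : Site P 0) (μ : Fin P.d) :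
    φ (Sect2.codiffCurlA ξ A x μ) =
      laplace ξ⁻¹ (fun z => φ (A ⟨z, μ⟩)) x - dE ξ⁻¹ (dsE ξ⁻¹ (WithLp.toLp 2 fun b => φ (A b))) ⟨x, μ⟩ := by
  rw [apply_codiffCurlA_eq_dcsE_dcE hadd hsmul, dcsE_dcE_apply_eq_laplace_sub]

/-! ## §2  The triangle inequality for the third row -/

/-- `|(∂*∂F)(b)| ≤ |(ΔF_{b_dir})(b₋)| + |(∂∂*F)(b)|`. [cite: Balaban1985Variational, (134) p.298 (bookkeeping)] -/
theorem abs_dcsE_dcE_le_add (c : ℝ) (F : BondSpace P) (b : PBond P 0) :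
    |dcsE c (dcE c F) b| ≤ |laplace c (fun z => F ⟨z, b.dir⟩) b.src| + |dE c (dsE c F) b| := by
  rw [dcsE_dcE_apply_eq_laplace_sub]
  exact abs_sub _ _

/-! ## §3  ★★★ The three letters from sup + gradient + LAPLACIAN + `∂∂*` rows -/

/-- ★★★ **PRINT's THREE LETTERS OF A MATRIX FIELD WITH THE SECOND-ORDER MEMBER THROUGH HODGE**: `Y ⊂ T_η`, `ξ > 0`, `𝔄 : bonds → M_N(ℂ)`, `0 ≤ q < t`, `q_Δ + q_P ≤ q`.  If
for every duality functional `φ = (y ↦ r·Re(u·f y))` and every bond `b` based in `Y`: `|φ(𝔄 b)| ≤ q`, `ξ⁻¹·|φ𝔄(b₋+e_κ, b_dir) − φ𝔄(b)| ≤ q` (all `κ`), the LAPLACIAN row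
`|(Δ^{ξ⁻¹}(φ∘𝔄)_{b_dir})(b₋)| ≤ q_Δ` (print (136): the V-slot bound of (158)) and the GRADIENT-OF-DIVERGENCE row `|(∂∂*(φ∘𝔄))(b)| ≤ q_P` (print: `∂∂*A₁ = ∂P∂*A₁`, [5] (3.49)),
then `Letters10On Y ξ t 𝔄` — FILE 1's `letters10On_of_realRows` with its third row supplied by §2.  The door for the `A₁` summand's second-order member (WIDTH-209 N07
piece 4). [cite: Balaban1985Variational, (134)–(136) p.298, (158)–(159) pp.302–303, (165) p.304; Balaban1985BackgroundPropagators, Thm 3.2 (3.49) p.399; Balaban1984PropagatorsI, (1.69) p.29] -/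
theorem letters10On_of_realRows_hodge [NeZero N] {Y : Set (Site P 0)} {ξ q qΔ qP t : ℝ} (hξ : 0 < ξ) (hq : 0 ≤ q) (hqt : q < t)
    (hsum : qΔ + qP ≤ q) {𝔄 : PBond P 0 → MatA N}
    (hrows : ∀ (f : StrongDual ℂ (MatA N)) (u : ℂ) (r : ℝ), (∀ y : MatA N, |r * (u * f y).re| ≤ ‖y‖) →
      ∀ b : PBond P 0, b.src ∈ Y →
        |r * (u * f (𝔄 b)).re| ≤ q ∧
        (∀ κ : Fin P.d, ξ⁻¹ * |r * (u * f (𝔄 ⟨b.src.shift κ, b.dir⟩)).re - r * (u * f (𝔄 b)).re| ≤ q) ∧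
        |laplace ξ⁻¹ (fun z => r * (u * f (𝔄 ⟨z, b.dir⟩)).re) b.src| ≤ qΔ ∧
        |dE ξ⁻¹ (dsE ξ⁻¹ (WithLp.toLp 2 fun b' => r * (u * f (𝔄 b')).re)) b| ≤ qP) :
    Letters10On Y ξ t 𝔄 := by
  refine letters10On_of_realRows hξ hq hqt fun f u r hf b hb => ?_
  obtain ⟨h1, h2, h3, h4⟩ := hrows f u r hf b hb
  refine ⟨h1, h2, ?_⟩
  calc |dcsE ξ⁻¹ (dcE ξ⁻¹ (WithLp.toLp 2 fun b' => r * (u * f (𝔄 b')).re)) b|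
      ≤ |laplace ξ⁻¹ (fun z => (WithLp.toLp 2 fun b' => r * (u * f (𝔄 b')).re) ⟨z, b.dir⟩) b.src| +
          |dE ξ⁻¹ (dsE ξ⁻¹ (WithLp.toLp 2 fun b' => r * (u * f (𝔄 b')).re)) b| := abs_dcsE_dcE_le_add _ _ _
    _ ≤ qΔ + qP := add_le_add h3 h4
    _ ≤ q := hsum

end Summit.QuantumFields.YangMills.BalabanUVNodes.N07SecondOrderLetterHodge

end
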